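/-
Copyright (c) 2026. All rights reserved.
Released under Apache 2.0 license as described in the file LICENSE.
Authors: abc-iut cell, F-lane seat abc-iut-f-187 (gen 3), KEY INST59L2.
-/
import Literature.IUT.LogVolume.Corollary22ThetaClosureData
import Literature.IUT.HodgeTheaters.ThetaGeometryInhabited
import Literature.IUT.LogVolume.Corollary22LegendreDeepAdmissiblePairs
import Literature.IUT.LogVolume.GenuineLogThetaPointNecessity
import HarnessLib

/-!
# [IUTchI] Def. 3.1 / [IUTchIV] Cor. 2.2 (ii) (P7): `Cor22.ThetaDataExistsAt` (FACT-LIST F-2786) — INSTANCE FORMS at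
# the genuine `λ_k = 1/2 + 2/7^k` family (proof-only)

S. Mochizuki, *Inter-universal Teichmüller theory I*, Definition 3.1 p. 46 (initial Θ-data `(F̄/F, X_F, l, C̲_K, V̲,
V^bad_mod, ε̲)`), and *IV*, Corollary 2.2 (ii), proof (P1)–(P7) pp. 45–46 ("there exist data … such that all of the
conditions of [IUTchI], Definition 3.1, (a)–(f), are satisfied"). [claim: Mochizuki2012, status: disputed] (D-0012 claim
key; nothing in this file bears on [IUTchIII] Cor. 3.12 or asserts anything about abc.)

PROOF-ONLY companion (no `def`, no `instance`, no notation) of abc-iut-c312-8's `GenuineLogThetaPoint.lean`, where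
`Cor22.ThetaDataExistsAt P l := Nonempty (ThetaVolumeDatumAt P l)` — the type of genuine Θ-volume data at the `λ`-line
point `P` and the prime `l` (v3 reading: generic carriers `F ⊇ F_tpd`, `K`, `F̄`, `E_F` with `j(E_F) = j(λ)`, the
`2·3·5`-torsion rationality, the sub-theta-field pinning, bad-place predicates `Pb`, initial Θ-data `D`, a genuine volume
input `I` of `D`, the (P5) choice).

Bookkeeping context (cell abc-iut, KEY row INST59L2).  The row is a SCHEMA in `(P, l)`: its universal closure and the
`l ≥ 5`-repaired closure are REFUTED in the tree (`exists_point_forall_not_thetaDataExistsAt`, `not_thetaDataExistsAt_five`,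
`not_thetaDataExistsAt_rat_zero`, …, `GenuineLogThetaPointNecessity.lean` / `…SchemaNegative.lean`), and its positive
content so far sits behind HYPOTHESES (`Cor22.thetaDataExistsAt_of_condP6_thetaClosure`; summit-side
`ThetaPartII.stub_thetaData`: `P ∈ U_P`, `l` prime `≥ 5`, `AdmitsCore`, (P2), (P5), (P6)) — the L-F kernel census found
NO instance form / `∃`-witness.  This file closes that gap WITHOUT new mathematics, by composing landed theorems:

* `Cor22.thetaDataExistsAt_of_condP2_condP5_condP6` — the Literature-side twin of the summit-side assembly
  `ThetaPartII.stub_thetaData` (which a Literature file cannot import): from `P ∈ U_P`, a prime `l ≥ 5`, `AdmitsCore`,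
  (P2), (P5), (P6) to `ThetaDataExistsAt P l`, the interface clauses [IUTchI] Def. 3.1 (d)(e)(f) being inhabited by the
  tree's LABELLED MODEL objects (`ThetaGeometryModel.nonempty_thetaGeometry_galois`, `BadPlacePredicates.trivial`) exactly
  as in `stub_thetaData`;
* `Cor22.exists_thetaDataExistsAt_ratPoint_lamSeven` — **INSTANCE FORM at GENUINE explicit points**: there is `k₀` such
  that for every `k ≥ k₀` the rational `λ`-line point `λ_k = 1/2 + 2/7^k` (`ratPoint λ_k`, `F_tpd = ℚ`) carries a genuine
  Θ-volume datum at some prime `l` with `11 ≤ l ≤ 60·k` — by abc-iut-w5-d044's UNCONDITIONAL admissible-pairs theorem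
  `Cor22.exists_admissible_prime_ratPoint_lamSeven` (Bertrand prime; (P6) from the tree's proved (P4) ⇒ (P6)
  `condP6_of_seven_le`, i.e. [GenEll] Lem. 3.5 as proved in the tree);
* `Cor22.exists_thetaDataExistsAt` — the 0-binder `∃`-witness `∃ P l, ThetaDataExistsAt P l`;
* `Cor22.thetaDataExistsAt_schema_both_ways` — the R5 record: inhabited at a genuine point, empty at another.

HONEST LABEL: the ARITHMETIC carriers of the witness are GENUINE (the λ-line point `λ_k` over `ℚ`, its theta-closure
field `F‡`, the curve `E_λ ⊗ F‡`, the `l`-division field, ideles), while the `π₁`-geometric interface clauses (d)(e)(f)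
of [IUTchI] Def. 3.1 are inhabited by the tree's labelled MODEL `ThetaGeometry` and the TRIVIAL bad-place predicates —
the same inhabitants the summit-side `stub_thetaData` uses; an instance-form theorem about OUR typed statement is not
the printed (P7); typed ≠ proved; no side taken.
-/

noncomputable section

namespace Literature.IUT.LogVolume

namespace Cor22

open NumberField IsDedekindDomain
open Literature.NumberTheory.DiophantineGeometry Literature.NumberTheory.DiophantineGeometry.GenEll
open Literature.IUT.HodgeTheaters

/-- **`ThetaDataExistsAt P l` from the (P2)(P5)(P6) conditions** (Literature-side twin of the summit's
`ThetaPartII.stub_thetaData`): for every `λ`-line point `P ∈ U_P` and prime `l ≥ 5` with `AdmitsCore`, (P2), (P5), (P6),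
a genuine Θ-volume datum exists at `(P, l)` — initial Θ-data on `(F‡(P), E_λ ⊗ F‡(P), l)` with `𝕍^bad_mod` the (P5)
choice and ideles in the genuine completions (`thetaDataExistsAt_of_condP6_thetaClosure`), over the tree's MODEL
inhabitants of the interface clauses [IUTchI] Def. 3.1 (d)(e)(f) (`ThetaGeometryModel.nonempty_thetaGeometry_galois`,
`BadPlacePredicates.trivial`). [claim: Mochizuki2012, status: disputed] -/
theorem thetaDataExistsAt_of_condP2_condP5_condP6 (P : NFPoint) (hP : P ∈ UP) (l : ℕ) (hl : l.Prime) (h5 : 5 ≤ l)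
    (hcore : AdmitsCore P) (hP2 : CondP2 P l) (hP5 : CondP5 P l) (h6 : CondP6 P l) :
    Literature.IUT.LogVolume.Cor22.ThetaDataExistsAt P l := by
  haveI : Fact P.InU := ⟨hP.1⟩
  haveI : (thetaCurve P (thetaClosureField P)).IsElliptic := thetaCurve_isElliptic hP.1 _
  haveI : NeZero l := ⟨hl.ne_zero⟩
  haveI : IsGalois (thetaClosureField P) (AlgebraicClosure (thetaClosureField P)) := {}
  have h7 : 7 ≤ l := seven_le_of_condP6 hP.1 hl h5 h6
  have h6cop : l.Coprime 6 := by
    rw [show (6 : ℕ) = 2 * 3 by norm_num]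
    exact Nat.Coprime.mul_right ((Nat.coprime_primes hl Nat.prime_two).2 (by omega))
      ((Nat.coprime_primes hl Nat.prime_three).2 (by omega))
  obtain ⟨geom⟩ := ThetaGeometryModel.nonempty_thetaGeometry_galois (thetaClosureField P)
    (TorsionField (thetaCurve P (thetaClosureField P)) l) (AlgebraicClosure (thetaClosureField P)) h5 h6cop
  exact thetaDataExistsAt_of_condP6_thetaClosure P hP hl h5 hcore hP2 hP5 h6 (BadPlacePredicates.trivial _) geom
    (fun w _ => (BadPlacePredicates.trivial_holds _ w).1) (fun w _ => (BadPlacePredicates.trivial_holds _ w).2)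

/-- **F-2786, INSTANCE FORM at the GENUINE `λ_k = 1/2 + 2/7^k` family**: there is `k₀` such that for every `k ≥ k₀`
there is a prime `l` with `11 ≤ l ≤ 60·k` at which a genuine Θ-volume datum EXISTS at the explicit rational `λ`-line
point `λ_k` (`F_tpd = ℚ`): the admissible pairs of abc-iut-w5-d044's unconditional
`exists_admissible_prime_ratPoint_lamSeven` (Bertrand prime above `log(q^∀)/log 2`; (P5) at the place over `7`;
(P6) by the proved (P4) ⇒ (P6)) fed to `thetaDataExistsAt_of_condP2_condP5_condP6`.  Arithmetic carriers genuine;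
interface clauses (d)(e)(f) at the tree's labelled model inhabitants. [claim: Mochizuki2012, status: disputed] -/
theorem exists_thetaDataExistsAt_ratPoint_lamSeven :
    ∃ k₀ : ℕ, ∀ k : ℕ, k₀ ≤ k → ∃ l : ℕ, l.Prime ∧ 11 ≤ l ∧ (l : ℝ) ≤ 60 * k ∧
      Literature.IUT.LogVolume.Cor22.ThetaDataExistsAt (ratPoint ((2 : ℚ)⁻¹ + 2 / 7 ^ k)) l := by
  obtain ⟨k₀, hk₀⟩ := exists_admissible_prime_ratPoint_lamSeven
  refine ⟨k₀, fun k hk => ?_⟩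
  obtain ⟨l, hl, h11, h60, -, hUP, -, -, hcore, hP2, hP5, hP6⟩ := hk₀ k hk
  exact ⟨l, hl, h11, h60,
    thetaDataExistsAt_of_condP2_condP5_condP6 _ hUP l hl (by omega) hcore hP2 hP5 hP6⟩

/-- **F-2786, `∃`-WITNESS (0 binders)**: the typed predicate "a genuine Θ-volume datum exists at `(P, l)`" is
INHABITED at some genuine `λ`-line point and prime (a `λ_k` over `ℚ` and a Bertrand prime `l ≥ 11`).
[claim: Mochizuki2012, status: disputed] -/
theorem exists_thetaDataExistsAt :
    ∃ (P : NFPoint) (l : ℕ), l.Prime ∧ 11 ≤ l ∧ Literature.IUT.LogVolume.Cor22.ThetaDataExistsAt P l := by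
  obtain ⟨k₀, hk₀⟩ := exists_thetaDataExistsAt_ratPoint_lamSeven
  obtain ⟨l, hl, h11, -, h⟩ := hk₀ k₀ le_rfl
  exact ⟨_, l, hl, h11, h⟩

/-- **R5 record for F-2786**: the schema `ThetaDataExistsAt` is inhabited at a genuine point and prime (above) and
EMPTY at another (`λ = 0` over `ℚ`, every `l`: the tree's `exists_point_forall_not_thetaDataExistsAt` restated through
its `∃`), so the row is consumable at named instances only. [claim: Mochizuki2012, status: disputed] -/
theorem thetaDataExistsAt_schema_both_ways :
    (∃ (P : NFPoint) (l : ℕ), Literature.IUT.LogVolume.Cor22.ThetaDataExistsAt P l) ∧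
      ∃ P : NFPoint, ∀ l : ℕ, ¬ Literature.IUT.LogVolume.Cor22.ThetaDataExistsAt P l := by
  refine ⟨?_, exists_point_forall_not_thetaDataExistsAt⟩
  obtain ⟨P, l, -, -, h⟩ := exists_thetaDataExistsAt
  exact ⟨P, l, h⟩

end Cor22

end Literature.IUT.LogVolume

end
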